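import Literature.NumberTheory.Sieve.CFSemigroupTransferComplex
import Literature.NumberTheory.Sieve.CFSemigroupCongruence
import HarnessLib

/-!
# The congruence transfer operator of Magee–Oh–Winter on `C¹(I; ℂ^{Γ_q})` (framework of Theorem 4)

M. Magee, H. Oh, D. Winter, *Uniform congruence counting for Schottky semigroups in `SL₂(𝐙)`*
(appendix by J. Bourgain, A. Kontorovich, M. Magee), J. reine angew. Math. 753 (2019) 89–135 =
arXiv:1601.03705 [MageeOhWinter2019]. This file sets up, for the continued fractions semigroup `Γ_A`
(§2.1 (II)), the objects in which the paper's main technical result **Theorem 4** ("Bounds for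
congruence transfer operators", §1 p. 4) is printed, so that Theorem 4 can be taken VERBATIM as a
hypothesis (see `CFSemigroupUniformCountingProof.lean`, where the named fact
`MageeOhWinter2019_uniformCounting` is derived from it). Everything here is a definition with a body or
a proved lemma; no result of the paper is asserted.

## The objects, as printed (§1 p. 4 and §2.1 (II) p. 5–6)

* `A` a finite set of at least two positive integers, `A_max` its largest member (`cfAmax`),
  `g_a = (0 1; 1 a)` acting by `g_a z = 1/(z + a)`; `Γ = Γ_A` is generated by the `g_a g_{a'}`.
* `I_A = [1/(A_max+1), 1]` (`cfIA`), `I_{a,a'} = g_a g_{a'} I_A` (`cfCyl`), a disjoint family of `#A²`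
  closed intervals (`cfCyl_eq_Icc`, `cfCyl_disjoint`), renamed `I_i` with `g_i = g_a g_{a'}`;
  `I = ⋃ I_i` (`cfI`); the expanding map `T : I → ℝ`, `T|_{I_i} = g_i⁻¹`; `τ(x) = log |T'(x)|` (§1 p. 4).
* `Γ_q = SL₂(ℤ/qℤ)`, `ℂ^{Γ_q}` with the standard Hermitian form (`CfVec q`, Mathlib `EuclideanSpace`),
  the cocycle `c_q|_{I_i} = g_i mod q` (Defn. 9) acting on `ℂ^{Γ_q}` "by the right regular
  representation", with the convention fixed by the paper's display `ρ(π_q(γ)).𝟙_ξ = 𝟙_{ξ π_q(γ)}`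
  (§3.1): `ρ(g) e_ξ = e_{ξ g}`, i.e. `(ρ(g) v)_η = v_{η g⁻¹}` (`cfRep`, `cfRep_single`).
* The congruence transfer operator `𝓛_{s,q}[F](x) = Σ_{T y = x} e^{-s τ(y)} c_q(y).F(y)` on
  `ℂ^{Γ_q}`-valued functions on `I` (§1 p. 4, §3.2 eq. (3.4)). For `x ∈ I ⊆ I_A` the `T`-preimages of `x`
  are exactly the points `y = g_i x ∈ I_i` (`cfMoeb_pair_mem_cfCyl`), and
  `e^{-s τ(g_i x)} = |T'(g_i x)|^{-s} = |g_i'(x)|^{s} = denom(g_i, x)^{-2s}`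
  (`hasDerivAt_cfMoeb`: `g'(x) = det g / denom(g,x)²`, `det g_i = 1`), which is the tree's weight
  `cfWt s g_i x = exp(-2 s log denom(g_i, x))`; this gives the closed formula `cfCongL`, which
  coincides coordinatewise with the tree's twisted operator `cfTwist` (`CFSemigroupTwisted.lean`,
  proved in `CFCongruenceTransferBridge.lean`).
* The Banach space `C¹(I; ℂ^{Γ_q})` with `‖f‖_{C¹} = ‖f‖_∞ + ‖f'‖_∞` (eq. (2.3)), pointwise norms being
  the Hermitian (`ℓ²`) norms: `c1NormOn (cfI A) F = sup_I ‖F‖ + sup_I ‖F'‖`, the derivative taken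
  within `I`.

## References

* [MageeOhWinter2019] M. Magee, H. Oh, D. Winter, J. reine angew. Math. 753 (2019) 89–135,
  arXiv:1601.03705: Thm. 4 (p. 4), §2.1 (II) (p. 5–6), Defn. 9, eq. (2.3), §3.1–3.2.
-/

noncomputable section

open Set Filter
open scoped MatrixGroups Topology

namespace Literature.NumberTheory.Sieve

variable {A : Finset ℕ}

/-! ### The intervals `I_A ⊇ I = ⋃ I_{a,a'}` of §2.1 (II) -/

/-- `A_max`, "the largest member of `A`" (MOW §2.1 (II) write `A`). `Finset.sup` of `∅` is the junk
value `0`, never used. [cite: MageeOhWinter2019, §2.1 (II)] -/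
def cfAmax (A : Finset ℕ) : ℕ := A.sup id

/-- Every member of `A` is at most `A_max`. [cite: MageeOhWinter2019, §2.1 (II)] -/
theorem le_cfAmax {a : ℕ} (ha : a ∈ A) : a ≤ cfAmax A := Finset.le_sup (f := id) ha

/-- `I_A = [1/(A_max + 1), 1]`. [cite: MageeOhWinter2019, §2.1 (II)] -/
def cfIA (A : Finset ℕ) : Set ℝ := Icc (1 / ((cfAmax A : ℝ) + 1)) 1

/-- The left endpoint `1/(A_max+1)` of `I_A` is positive. [folklore] -/
theorem cfIA_left_pos (A : Finset ℕ) : 0 < 1 / ((cfAmax A : ℝ) + 1) := by positivity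

/-- `I_A ⊆ [0, 1]`. [folklore] -/
theorem cfIA_subset_Icc (A : Finset ℕ) : cfIA A ⊆ Icc (0 : ℝ) 1 :=
  Icc_subset_Icc_left (cfIA_left_pos A).le

/-- The cylinder `I_{a,a'} = g_a g_{a'} I_A`. [cite: MageeOhWinter2019, §2.1 (II)] -/
def cfCyl (A : Finset ℕ) (a a' : ℕ) : Set ℝ := cfMoeb (cfGen a * cfGen a') '' cfIA A

/-- `I = ⋃_{a,a' ∈ A} I_{a,a'}`, the domain of the expanding map `T` (`T|_{I_{a,a'}} = (g_a g_{a'})⁻¹`).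
[cite: MageeOhWinter2019, §2.1 (II)] -/
def cfI (A : Finset ℕ) : Set ℝ := ⋃ a ∈ A, ⋃ a' ∈ A, cfCyl A a a'

/-- Membership in `I`. [folklore] -/
theorem mem_cfI {x : ℝ} : x ∈ cfI A ↔ ∃ a ∈ A, ∃ a' ∈ A, x ∈ cfCyl A a a' := by
  simp only [cfI, mem_iUnion, exists_prop]

/-- For `x ∈ I_A` the point `g_a g_{a'} x` lies in the cylinder `I_{a,a'}`: the `T`-preimages of a
point of `I ⊆ I_A` are the points `g_i x`, one in each `I_i`. [cite: MageeOhWinter2019, §2.1 (II)] -/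
theorem cfMoeb_pair_mem_cfCyl (a a' : ℕ) {x : ℝ} (hx : x ∈ cfIA A) :
    cfMoeb (cfGen a * cfGen a') x ∈ cfCyl A a a' := mem_image_of_mem _ hx

/-- The cylinders are contained in `I`. [cite: MageeOhWinter2019, §2.1 (II)] -/
theorem cfCyl_subset_cfI {a a' : ℕ} (ha : a ∈ A) (ha' : a' ∈ A) : cfCyl A a a' ⊆ cfI A :=
  fun _ hx => mem_cfI.2 ⟨a, ha, a', ha', hx⟩

/-- `g_a g_{a'} = (1 a'; a 1 + a a')`. [folklore] -/
theorem cfGen_mul_cfGen (a a' : ℕ) : cfGen a * cfGen a' = !![1, (a' : ℤ); (a : ℤ), 1 + a * a'] := by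
  ext i j
  fin_cases i <;> fin_cases j <;> simp [cfGen, Matrix.mul_apply, Fin.sum_univ_two]

/-- The denominator of `g_a g_{a'}` at `x` is `a (x + a') + 1`. [folklore] -/
theorem cfDenom_pair (a a' : ℕ) (x : ℝ) : cfDenom (cfGen a * cfGen a') x = a * (x + a') + 1 := by
  rw [cfGen_mul_cfGen]; simp [cfDenom]; ring

/-- `g_a g_{a'} x = (x + a')/(a (x + a') + 1)`. [folklore] -/
theorem cfMoeb_pair (a a' : ℕ) (x : ℝ) : cfMoeb (cfGen a * cfGen a') x = (x + a') / (a * (x + a') + 1) := by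
  rw [cfGen_mul_cfGen]; simp [cfMoeb]; ring

/-- The denominator of `g_a g_{a'}` is `≥ 1` on `x ≥ 0`. [folklore] -/
theorem one_le_cfDenom_pair (a a' : ℕ) {x : ℝ} (hx : 0 ≤ x) : 1 ≤ cfDenom (cfGen a * cfGen a') x := by
  rw [cfDenom_pair]; nlinarith [Nat.cast_nonneg (α := ℝ) a, Nat.cast_nonneg (α := ℝ) a']

/-- `x ↦ g_a g_{a'} x` is monotone on `[0, ∞)` (a composite of two decreasing maps). [folklore] -/
theorem cfMoeb_pair_mono {a a' : ℕ} (ha : 1 ≤ a) {x y : ℝ} (hx : 0 ≤ x) (hxy : x ≤ y) :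
    cfMoeb (cfGen a * cfGen a') x ≤ cfMoeb (cfGen a * cfGen a') y := by
  rw [cfMoeb_pair, cfMoeb_pair]
  have ha1 : (1 : ℝ) ≤ a := by exact_mod_cast ha
  have ha'0 : (0 : ℝ) ≤ a' := Nat.cast_nonneg a'
  rw [div_le_div_iff₀ (by nlinarith) (by nlinarith)]
  nlinarith

/-- `g_a g_{a'} x` is `1`-Lipschitz on `[0, ∞)`: `|g x - g y| ≤ |x - y|`. [folklore] -/
theorem abs_cfMoeb_pair_sub_le {a a' : ℕ} (ha : 1 ≤ a) (ha' : 1 ≤ a') {x y : ℝ} (hx : 0 ≤ x) (hy : 0 ≤ y) :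
    |cfMoeb (cfGen a * cfGen a') x - cfMoeb (cfGen a * cfGen a') y| ≤ |x - y| := by
  rw [cfMoeb_pair, cfMoeb_pair]
  have ha1 : (1 : ℝ) ≤ a := by exact_mod_cast ha
  have ha'1 : (1 : ℝ) ≤ a' := by exact_mod_cast ha'
  have hdx : 0 < a * (x + a') + 1 := by nlinarith
  have hdy : 0 < a * (y + a') + 1 := by nlinarith
  rw [div_sub_div _ _ hdx.ne' hdy.ne', abs_div, abs_of_pos (mul_pos hdx hdy), div_le_iff₀ (mul_pos hdx hdy)]
  have e : (x + a') * (a * (y + a') + 1) - (a * (x + a') + 1) * (y + a') = x - y := by ring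
  rw [e]
  have h1 : (1 : ℝ) ≤ (a * (x + a') + 1) * (a * (y + a') + 1) :=
    one_le_mul_of_one_le_of_one_le (by nlinarith) (by nlinarith)
  nlinarith [abs_nonneg (x - y)]

/-- **Two steps land in `I_A`:** for `x ∈ [0,1]`, `g_a g_{a'} x ∈ I_A` whenever `a ≤ A_max`, `a' ≥ 1`
(`g_a g_{a'}[0,1] = [a'/(a a'+1), (a'+1)/(a a'+a+1)] ⊆ [1/(A_max+1), 1]`). [cite: MageeOhWinter2019, §2.1 (II)] -/
theorem cfMoeb_pair_mem_cfIA {a a' : ℕ} (ha : a ∈ A) (ha1 : 1 ≤ a) (ha' : 1 ≤ a') {x : ℝ} (hx : x ∈ Icc (0 : ℝ) 1) :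
    cfMoeb (cfGen a * cfGen a') x ∈ cfIA A := by
  have hamax : (a : ℝ) ≤ cfAmax A := by exact_mod_cast le_cfAmax ha
  have ha1' : (1 : ℝ) ≤ a := by exact_mod_cast ha1
  have ha'1 : (1 : ℝ) ≤ a' := by exact_mod_cast ha'
  rw [cfMoeb_pair]
  have hd : 0 < a * (x + a') + 1 := by nlinarith [hx.1]
  constructor
  · rw [div_le_div_iff₀ (by positivity) hd]
    nlinarith [hx.1, hx.2]
  · rw [div_le_one hd]
    nlinarith [hx.1]

/-- The cylinders lie in `I_A`. [cite: MageeOhWinter2019, §2.1 (II)] -/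
theorem cfCyl_subset_cfIA {a a' : ℕ} (ha : a ∈ A) (ha1 : 1 ≤ a) (ha' : 1 ≤ a') : cfCyl A a a' ⊆ cfIA A := by
  rintro _ ⟨x, hx, rfl⟩
  exact cfMoeb_pair_mem_cfIA ha ha1 ha' (cfIA_subset_Icc A hx)

/-- `I ⊆ I_A`. [cite: MageeOhWinter2019, §2.1 (II)] -/
theorem cfI_subset_cfIA (hA : ∀ a ∈ A, 1 ≤ a) : cfI A ⊆ cfIA A := by
  intro x hx
  obtain ⟨a, ha, a', ha', hx⟩ := mem_cfI.1 hx
  exact cfCyl_subset_cfIA ha (hA a ha) (hA a' ha') hx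

/-- `I ⊆ [0, 1]`. [folklore] -/
theorem cfI_subset_Icc (hA : ∀ a ∈ A, 1 ≤ a) : cfI A ⊆ Icc (0 : ℝ) 1 :=
  (cfI_subset_cfIA hA).trans (cfIA_subset_Icc A)

/-- **The cylinders are closed intervals:** `I_{a,a'} = [g_a g_{a'}(1/(A_max+1)), g_a g_{a'}(1)]`.
[cite: MageeOhWinter2019, §2.1 (II)] -/
theorem cfCyl_eq_Icc {a a' : ℕ} (ha : 1 ≤ a) :
    cfCyl A a a' = Icc (cfMoeb (cfGen a * cfGen a') (1 / ((cfAmax A : ℝ) + 1))) (cfMoeb (cfGen a * cfGen a') 1) := by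
  have hα := (cfIA_left_pos A).le
  refine Subset.antisymm ?_ ?_
  · rintro _ ⟨x, hx, rfl⟩
    exact ⟨cfMoeb_pair_mono ha hα hx.1, cfMoeb_pair_mono ha (hα.trans hx.1) hx.2⟩
  · have hcont : ContinuousOn (cfMoeb (cfGen a * cfGen a')) (cfIA A) := by
      refine fun x hx => (ContinuousAt.continuousWithinAt ?_)
      have hd : cfDenom (cfGen a * cfGen a') x ≠ 0 :=
        (lt_of_lt_of_le one_pos (one_le_cfDenom_pair a a' (hα.trans hx.1))).ne'
      exact (hasDerivAt_cfMoeb' (cfGen a * cfGen a') hd).continuousAt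
    have h1 : 1 / ((cfAmax A : ℝ) + 1) ≤ 1 := by
      rw [div_le_one (by positivity)]; linarith [Nat.cast_nonneg (α := ℝ) (cfAmax A)]
    exact intermediate_value_Icc h1 hcont
where
  /-- local restatement of the derivative of a Möbius map (continuity is all that is used here). [folklore] -/
  hasDerivAt_cfMoeb' (M : Matrix (Fin 2) (Fin 2) ℤ) {x : ℝ} (hx : cfDenom M x ≠ 0) :
      HasDerivAt (cfMoeb M) ((M.det : ℝ) / (cfDenom M x) ^ 2) x := by
    have hnum : HasDerivAt (fun y : ℝ => (M 0 0 : ℝ) * y + M 0 1) (M 0 0 : ℝ) x := by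
      simpa using ((hasDerivAt_id x).const_mul (M 0 0 : ℝ)).add_const (M 0 1 : ℝ)
    have hden : HasDerivAt (fun y : ℝ => (M 1 0 : ℝ) * y + M 1 1) (M 1 0 : ℝ) x := by
      simpa using ((hasDerivAt_id x).const_mul (M 1 0 : ℝ)).add_const (M 1 1 : ℝ)
    have h := hnum.fun_div hden (by simpa [cfDenom] using hx)
    refine (h.congr_deriv ?_).congr_of_eventuallyEq (Eventually.of_forall fun y => rfl)
    rw [Matrix.det_fin_two]
    simp only [cfDenom, Int.cast_sub, Int.cast_mul]
    ring

/-- **The derivative of a Möbius map:** `(M·)'(x) = det M / denom(M, x)²` wherever the denominator does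
not vanish; for `g_i = g_a g_{a'}` (`det = 1`) this is `|g_i'(x)| = denom(g_i, x)^{-2}`, so that
`e^{-s τ(g_i x)} = |T'(g_i x)|^{-s} = |g_i'(x)|^{s} = denom(g_i,x)^{-2s}` is the tree's weight `cfWt s g_i x`.
[folklore] -/
theorem hasDerivAt_cfMoeb (M : Matrix (Fin 2) (Fin 2) ℤ) {x : ℝ} (hx : cfDenom M x ≠ 0) :
    HasDerivAt (cfMoeb M) ((M.det : ℝ) / (cfDenom M x) ^ 2) x :=
  cfCyl_eq_Icc.hasDerivAt_cfMoeb' M hx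

/-- The derivative of `g_a g_{a'}` is `denom^{-2} ∈ (0, 1]` on `x ≥ 0`. [folklore] -/
theorem hasDerivAt_cfMoeb_pair (a a' : ℕ) {x : ℝ} (hx : 0 ≤ x) :
    HasDerivAt (cfMoeb (cfGen a * cfGen a')) (1 / (cfDenom (cfGen a * cfGen a') x) ^ 2) x := by
  have hd : cfDenom (cfGen a * cfGen a') x ≠ 0 := (lt_of_lt_of_le one_pos (one_le_cfDenom_pair a a' hx)).ne'
  have h := hasDerivAt_cfMoeb (cfGen a * cfGen a') hd
  have hdet : ((cfGen a * cfGen a').det : ℝ) = 1 := by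
    rw [Matrix.det_mul, det_cfGen, det_cfGen]; norm_num
  rwa [hdet] at h

/-- The cylinders are nondegenerate intervals (left endpoint `<` right endpoint). [folklore] -/
theorem cfCyl_endpoints_lt {a a' : ℕ} (ha : 1 ≤ a) (hAm : 1 ≤ cfAmax A) :
    cfMoeb (cfGen a * cfGen a') (1 / ((cfAmax A : ℝ) + 1)) < cfMoeb (cfGen a * cfGen a') 1 := by
  rw [cfMoeb_pair, cfMoeb_pair]
  have ha1 : (1 : ℝ) ≤ a := by exact_mod_cast ha
  have hm : (1 : ℝ) ≤ cfAmax A := by exact_mod_cast hAm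
  have ha'0 : (0 : ℝ) ≤ a' := Nat.cast_nonneg a'
  set α : ℝ := 1 / ((cfAmax A : ℝ) + 1) with hα
  have hα1 : α < 1 := by rw [hα, div_lt_one (by positivity)]; linarith
  have hα0 : 0 < α := by positivity
  rw [div_lt_div_iff₀ (by nlinarith) (by nlinarith)]
  nlinarith

/-- **Ordering of the cylinders, first letter:** for `a < ã` every point of `I_{ã,ã'}` lies strictly
to the left of every point of `I_{a,a'}`. [cite: MageeOhWinter2019, §2.1 (II)] -/
theorem cfCyl_lt_of_lt_fst {a a' b b' : ℕ} (ha : 1 ≤ a) (ha' : 1 ≤ a') (hab : a < b)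
    {x y : ℝ} (hx : x ∈ cfCyl A a a') (hy : y ∈ cfCyl A b b') : y < x := by
  obtain ⟨u, hu, rfl⟩ := hx
  obtain ⟨v, hv, rfl⟩ := hy
  rw [cfMoeb_pair, cfMoeb_pair]
  have hu0 : 0 < u := lt_of_lt_of_le (cfIA_left_pos A) hu.1
  have hv0 : 0 < v := lt_of_lt_of_le (cfIA_left_pos A) hv.1
  have ha1 : (1 : ℝ) ≤ a := by exact_mod_cast ha
  have ha'1 : (1 : ℝ) ≤ a' := by exact_mod_cast ha'
  have hb1 : (a : ℝ) + 1 ≤ b := by exact_mod_cast hab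
  have hb'0 : (0 : ℝ) ≤ b' := Nat.cast_nonneg b'
  rw [div_lt_div_iff₀ (by nlinarith) (by nlinarith)]
  -- `(v+b')(a(u+a')+1) < (u+a')(b(v+b')+1)` since `b ≥ a+1` and `u + a' > 1`
  have key : (u + a') * (b * (v + b') + 1) - (v + b') * (a * (u + a') + 1) =
      ((b : ℝ) - a) * ((u + a') * (v + b')) + ((u + a') - (v + b')) := by ring
  have hX1 : 0 ≤ u + a' - 1 := by linarith
  have hY : 0 ≤ v + b' := by linarith
  have hXY : 0 ≤ (u + a') * (v + b') := mul_nonneg (by linarith) hY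
  nlinarith [mul_nonneg (by linarith : (0 : ℝ) ≤ (b : ℝ) - a - 1) hXY, mul_nonneg hY hX1]

/-- **Ordering of the cylinders, second letter:** for `a' < ã'` every point of `I_{a,a'}` lies strictly
to the left of every point of `I_{a,ã'}`. [cite: MageeOhWinter2019, §2.1 (II)] -/
theorem cfCyl_lt_of_lt_snd {a a' b' : ℕ} (ha : 1 ≤ a) (ha' : 1 ≤ a') (hab : a' < b')
    {x y : ℝ} (hx : x ∈ cfCyl A a a') (hy : y ∈ cfCyl A a b') : x < y := by
  obtain ⟨u, hu, rfl⟩ := hx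
  obtain ⟨v, hv, rfl⟩ := hy
  rw [cfMoeb_pair, cfMoeb_pair]
  have hu0 : 0 < u := lt_of_lt_of_le (cfIA_left_pos A) hu.1
  have hv0 : 0 < v := lt_of_lt_of_le (cfIA_left_pos A) hv.1
  have ha1 : (1 : ℝ) ≤ a := by exact_mod_cast ha
  have ha'1 : (1 : ℝ) ≤ a' := by exact_mod_cast ha'
  have hb1 : (a' : ℝ) + 1 ≤ b' := by exact_mod_cast hab
  rw [div_lt_div_iff₀ (by nlinarith) (by nlinarith)]
  nlinarith [hu.2, hv.2]

/-- **The cylinders are pairwise disjoint.** [cite: MageeOhWinter2019, §2.1 (II)] -/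
theorem cfCyl_disjoint {a a' b b' : ℕ} (ha : 1 ≤ a) (ha' : 1 ≤ a') (hb : 1 ≤ b) (hb' : 1 ≤ b')
    (hne : (a, a') ≠ (b, b')) {x : ℝ} (hx : x ∈ cfCyl A a a') : x ∉ cfCyl A b b' := by
  intro hx'
  rcases lt_trichotomy a b with h | rfl | h
  · exact lt_irrefl _ (cfCyl_lt_of_lt_fst ha ha' h hx hx')
  · rcases lt_trichotomy a' b' with h' | rfl | h'
    · exact lt_irrefl _ (cfCyl_lt_of_lt_snd ha ha' h' hx hx')
    · exact hne rfl
    · exact lt_irrefl _ (cfCyl_lt_of_lt_snd ha hb' h' hx' hx)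
  · exact lt_irrefl _ (cfCyl_lt_of_lt_fst hb hb' h hx' hx)

/-- The cylinders are closed. [folklore] -/
theorem isClosed_cfCyl {a a' : ℕ} (ha : 1 ≤ a) : IsClosed (cfCyl A a a') := by
  rw [cfCyl_eq_Icc ha]; exact isClosed_Icc

/-- **Each cylinder is relatively open in `I`:** `I_{a,a'}` is a neighbourhood of each of its points
within `I` (the finitely many other cylinders are closed and disjoint from it). [folklore] -/
theorem cfCyl_mem_nhdsWithin (hA : ∀ a ∈ A, 1 ≤ a) {a a' : ℕ} (ha : a ∈ A) (ha' : a' ∈ A) {x : ℝ}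
    (hx : x ∈ cfCyl A a a') : cfCyl A a a' ∈ 𝓝[cfI A] x := by
  -- the union of the other cylinders is closed and misses `x`
  set S : Finset (ℕ × ℕ) := (A ×ˢ A).filter fun p => p ≠ (a, a') with hS
  set U : Set ℝ := (⋃ p ∈ S, cfCyl A p.1 p.2)ᶜ with hU
  have hUo : IsOpen U := by
    rw [hU, isOpen_compl_iff]
    refine isClosed_biUnion_finset fun p hp => ?_
    rw [hS, Finset.mem_filter, Finset.mem_product] at hp
    exact isClosed_cfCyl (hA _ hp.1.1)
  have hxU : x ∈ U := by
    rw [hU, mem_compl_iff, mem_iUnion₂]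
    rintro ⟨p, hp, hxp⟩
    rw [hS, Finset.mem_filter, Finset.mem_product] at hp
    exact cfCyl_disjoint (hA a ha) (hA a' ha') (hA _ hp.1.1) (hA _ hp.1.2) (Ne.symm hp.2) hx hxp
  have hsub : cfI A ∩ U ⊆ cfCyl A a a' := by
    rintro y ⟨hy, hyU⟩
    obtain ⟨b, hb, b', hb', hyb⟩ := mem_cfI.1 hy
    by_cases hp : (b, b') = (a, a')
    · rw [Prod.mk.injEq] at hp; rwa [hp.1, hp.2] at hyb
    · exfalso
      rw [hU, mem_compl_iff, mem_iUnion₂] at hyU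
      exact hyU ⟨(b, b'), by rw [hS, Finset.mem_filter, Finset.mem_product]; exact ⟨⟨hb, hb'⟩, hp⟩, hyb⟩
  exact mem_of_superset (inter_mem_nhdsWithin _ (hUo.mem_nhds hxU)) hsub

/-- Within `I`, near a point of `I_{a,a'}`, the neighbourhood filters of `I` and of `I_{a,a'}` agree.
[folklore] -/
theorem nhdsWithin_cfI_eq (hA : ∀ a ∈ A, 1 ≤ a) {a a' : ℕ} (ha : a ∈ A) (ha' : a' ∈ A) {x : ℝ}
    (hx : x ∈ cfCyl A a a') : 𝓝[cfI A] x = 𝓝[cfCyl A a a'] x := by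
  rw [← nhdsWithin_inter_of_mem (cfCyl_mem_nhdsWithin hA ha ha' hx),
    inter_eq_self_of_subset_left (cfCyl_subset_cfI ha ha')]

/-- `1 ≤ A_max` as soon as `A` is a nonempty set of positive integers. [folklore] -/
theorem one_le_cfAmax (hA : ∀ a ∈ A, 1 ≤ a) (hne : A.Nonempty) : 1 ≤ cfAmax A := by
  obtain ⟨a, ha⟩ := hne
  exact (hA a ha).trans (le_cfAmax ha)

/-- `I` is a set of unique differentiability (a finite union of nondegenerate closed intervals).
[folklore] -/
theorem uniqueDiffOn_cfI (hA : ∀ a ∈ A, 1 ≤ a) : UniqueDiffOn ℝ (cfI A) := by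
  intro x hx
  obtain ⟨a, ha, a', ha', hxc⟩ := mem_cfI.1 hx
  have hne : A.Nonempty := ⟨a, ha⟩
  have hlt := cfCyl_endpoints_lt (A := A) (a' := a') (hA a ha) (one_le_cfAmax hA hne)
  have h := uniqueDiffOn_Icc hlt
  rw [← cfCyl_eq_Icc (hA a ha)] at h
  exact (h x hxc).mono (cfCyl_subset_cfI ha ha')

/-! ### `ℂ^{Γ_q}`, the right regular representation and the congruence transfer operator -/

/-- `ℂ^{Γ_q}`, `Γ_q = SL₂(ℤ/qℤ)` (`q ≥ 1`), with "the standard Hermitian form that comes from the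
identification of `Γ_q` with the standard basis" (§1 p. 4): Mathlib's `EuclideanSpace`.
[cite: MageeOhWinter2019, §1] -/
abbrev CfVec (q : ℕ) [NeZero q] : Type := EuclideanSpace ℂ (SL(2, ZMod q))

section Vec

variable {q : ℕ} [NeZero q]

/-- The right regular representation in the paper's convention `ρ(g) e_ξ = e_{ξ g}` (display
`ρ(π_q(γ)).𝟙_ξ = 𝟙_{ξ π_q(γ)}`, §3.1), i.e. `(ρ(g) v)_η = v_{η g⁻¹}`. [cite: MageeOhWinter2019, §1 and §3.1] -/
def cfRep (g : SL(2, ZMod q)) (v : CfVec q) : CfVec q :=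
  WithLp.toLp 2 fun η => v (η * g⁻¹)

/-- Coordinates of `ρ(g) v`. [cite: MageeOhWinter2019, §3.1] -/
@[simp] theorem cfRep_apply (g : SL(2, ZMod q)) (v : CfVec q) (η : SL(2, ZMod q)) :
    cfRep g v η = v (η * g⁻¹) := rfl

/-- `ρ(g) e_ξ = e_{ξ g}` (the paper's display, with `e_ξ = 𝟙_ξ` the standard basis vector).
[cite: MageeOhWinter2019, §3.1] -/
theorem cfRep_single (g ξ : SL(2, ZMod q)) :
    cfRep g (PiLp.single 2 ξ (1 : ℂ)) = PiLp.single 2 (ξ * g) 1 := by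
  ext η
  simp only [cfRep_apply, PiLp.single_apply, mul_inv_eq_iff_eq_mul]

/-- `ρ(g)` is additive. [folklore] -/
@[simp] theorem cfRep_add (g : SL(2, ZMod q)) (v w : CfVec q) : cfRep g (v + w) = cfRep g v + cfRep g w := by
  ext η; simp

/-- `ρ(g)` is homogeneous. [folklore] -/
@[simp] theorem cfRep_smul (g : SL(2, ZMod q)) (c : ℂ) (v : CfVec q) : cfRep g (c • v) = c • cfRep g v := by
  ext η; simp

/-- `ρ(g) 0 = 0`. [folklore] -/
@[simp] theorem cfRep_zero (g : SL(2, ZMod q)) : cfRep g (0 : CfVec q) = 0 := by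
  ext η; simp

/-- `ρ(g)` is subtractive. [folklore] -/
@[simp] theorem cfRep_sub (g : SL(2, ZMod q)) (v w : CfVec q) : cfRep g (v - w) = cfRep g v - cfRep g w := by
  ext η; simp

/-- `ρ(g)` is negation-compatible. [folklore] -/
@[simp] theorem cfRep_neg (g : SL(2, ZMod q)) (v : CfVec q) : cfRep g (-v) = -cfRep g v := by
  ext η; simp

/-- **`ρ(g)` is an isometry** of `ℂ^{Γ_q}` (a coordinate permutation). [cite: MageeOhWinter2019, §1] -/
@[simp] theorem norm_cfRep (g : SL(2, ZMod q)) (v : CfVec q) : ‖cfRep g v‖ = ‖v‖ := by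
  rw [EuclideanSpace.norm_eq, EuclideanSpace.norm_eq]
  congr 1
  exact Fintype.sum_equiv (Equiv.mulRight g⁻¹) _ _ fun η => rfl

/-- `ρ(g)` preserves the sum of the coordinates (so it preserves `ℂ^{Γ_q} ⊖ 1`). [folklore] -/
theorem sum_cfRep_apply (g : SL(2, ZMod q)) (v : CfVec q) : ∑ η, cfRep g v η = ∑ η, v η := by
  simp only [cfRep_apply]
  exact Fintype.sum_equiv (Equiv.mulRight g⁻¹) _ _ fun η => rfl

/-- `ρ(g)` as a continuous linear map (an isometry). [cite: MageeOhWinter2019, §1] -/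
def cfRepL (g : SL(2, ZMod q)) : CfVec q →L[ℂ] CfVec q :=
  LinearMap.mkContinuous ⟨⟨cfRep g, cfRep_add g⟩, cfRep_smul g⟩ 1 fun v => by
    simp only [LinearMap.coe_mk, AddHom.coe_mk]
    rw [norm_cfRep, one_mul]

/-- `cfRepL g` is `ρ(g)`. [folklore] -/
@[simp] theorem cfRepL_apply (g : SL(2, ZMod q)) (v : CfVec q) : cfRepL g v = cfRep g v := rfl

/-- `ρ(g)` is continuous. [folklore] -/
theorem continuous_cfRep (g : SL(2, ZMod q)) : Continuous (cfRep (q := q) g) := (cfRepL g).continuous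

/-- Coordinates are bounded by the Hermitian norm. [folklore] -/
theorem norm_apply_le_norm_cfVec (v : CfVec q) (η : SL(2, ZMod q)) : ‖v η‖ ≤ ‖v‖ :=
  PiLp.norm_apply_le v η

/-- The Hermitian norm is bounded by `√|Γ_q|` times the largest coordinate. [folklore] -/
theorem norm_cfVec_le_of_forall_le (v : CfVec q) {C : ℝ} (hC : 0 ≤ C) (h : ∀ η, ‖v η‖ ≤ C) :
    ‖v‖ ≤ Real.sqrt (Fintype.card (SL(2, ZMod q))) * C := by
  rw [EuclideanSpace.norm_eq]
  have hsum : ∑ η, ‖v η‖ ^ 2 ≤ (Fintype.card (SL(2, ZMod q)) : ℝ) * C ^ 2 := by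
    calc ∑ η, ‖v η‖ ^ 2 ≤ ∑ _η : SL(2, ZMod q), C ^ 2 :=
          Finset.sum_le_sum fun η _ => pow_le_pow_left₀ (norm_nonneg _) (h η) 2
      _ = (Fintype.card (SL(2, ZMod q)) : ℝ) * C ^ 2 := by
          rw [Finset.sum_const, Finset.card_univ, nsmul_eq_mul]
  calc Real.sqrt (∑ η, ‖v η‖ ^ 2) ≤ Real.sqrt ((Fintype.card (SL(2, ZMod q)) : ℝ) * C ^ 2) := Real.sqrt_le_sqrt hsum
    _ = Real.sqrt (Fintype.card (SL(2, ZMod q))) * C := by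
        rw [Real.sqrt_mul (Nat.cast_nonneg _), Real.sqrt_sq hC]

/-- The "sum of coordinates" functional `v ↦ Σ_ξ v_ξ` on `ℂ^{Γ_q}`; its kernel is `ℂ^{Γ_q} ⊖ 1`, the
orthogonal complement of the constants for the standard Hermitian form. [cite: MageeOhWinter2019, §1] -/
def cfSumCoord (q : ℕ) [NeZero q] : CfVec q →L[ℂ] ℂ := ∑ ξ : SL(2, ZMod q), (EuclideanSpace.proj ξ : CfVec q →L[ℂ] ℂ)

/-- `cfSumCoord v = Σ_ξ v_ξ`. [folklore] -/
@[simp] theorem cfSumCoord_apply (v : CfVec q) : cfSumCoord q v = ∑ ξ, v ξ := by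
  simp [cfSumCoord]

/-- `Σ_ξ (ρ(g) v)_ξ = Σ_ξ v_ξ`: the constraint `cfSumCoord = 0` is `ρ`-stable. [folklore] -/
theorem cfSumCoord_cfRep (g : SL(2, ZMod q)) (v : CfVec q) : cfSumCoord q (cfRep g v) = cfSumCoord q v := by
  rw [cfSumCoord_apply, cfSumCoord_apply, sum_cfRep_apply]

end Vec

/-- **The congruence transfer operator `𝓛_{s,q}` of `Γ_A`** (§1 p. 4; §3.2 eq. (3.4)):
`𝓛_{s,q}[F](x) = Σ_{T y = x} e^{-s τ(y)} c_q(y).F(y) = Σ_{a,a' ∈ A} |g_i'(x)|^{s} ρ(g_i mod q) F(g_i x)`,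
`g_i = g_a g_{a'}`, written with the tree's weight `cfWt s g_i x = denom(g_i,x)^{-2s} = |g_i'(x)|^s` and
Möbius action `cfMoeb`. (Defined by this formula for every real `x`; only its values on `I` matter.)
[cite: MageeOhWinter2019, §1 (p. 4) and §3.2 eq. (3.4)] -/
def cfCongL (A : Finset ℕ) (q : ℕ) [NeZero q] (s : ℂ) (F : ℝ → CfVec q) (x : ℝ) : CfVec q :=
  ∑ a ∈ A, ∑ a' ∈ A,
    cfWt s (cfGen a * cfGen a') x • cfRep (cfRed q (cfPair a a')) (F (cfMoeb (cfGen a * cfGen a') x))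

section CongL

variable (A) {q : ℕ} [NeZero q]

/-- Coordinates of `𝓛_{s,q}[F](x)`: `(𝓛_{s,q}F)(x)_η = Σ_{a,a'} denom(g_a g_{a'}, x)^{-2s} F(g_a g_{a'} x)_{η π_q(g_a g_{a'})⁻¹}`.
[cite: MageeOhWinter2019, §3.2 eq. (3.4)] -/
theorem cfCongL_apply_coord (s : ℂ) (F : ℝ → CfVec q) (x : ℝ) (η : SL(2, ZMod q)) :
    cfCongL A q s F x η = ∑ a ∈ A, ∑ a' ∈ A,
      cfWt s (cfGen a * cfGen a') x * F (cfMoeb (cfGen a * cfGen a') x) (η * (cfRed q (cfPair a a'))⁻¹) := by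
  simp only [cfCongL, WithLp.ofLp_sum, Finset.sum_apply, WithLp.ofLp_smul, Pi.smul_apply, cfRep_apply,
    smul_eq_mul]

/-- `𝓛_{s,q}` is additive (pointwise). [folklore] -/
theorem cfCongL_add (s : ℂ) (F G : ℝ → CfVec q) (x : ℝ) :
    cfCongL A q s (F + G) x = cfCongL A q s F x + cfCongL A q s G x := by
  simp only [cfCongL, Pi.add_apply, cfRep_add, smul_add, Finset.sum_add_distrib]

/-- `𝓛_{s,q}` is homogeneous (pointwise). [folklore] -/
theorem cfCongL_smul (s : ℂ) (c : ℂ) (F : ℝ → CfVec q) (x : ℝ) :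
    cfCongL A q s (c • F) x = c • cfCongL A q s F x := by
  simp only [cfCongL, Pi.smul_apply, cfRep_smul, smul_comm _ c, Finset.smul_sum]

/-- `𝓛_{s,q}` is subtractive (pointwise). [folklore] -/
theorem cfCongL_sub (s : ℂ) (F G : ℝ → CfVec q) (x : ℝ) :
    cfCongL A q s (F - G) x = cfCongL A q s F x - cfCongL A q s G x := by
  simp only [cfCongL, Pi.sub_apply, cfRep_sub, smul_sub, Finset.sum_sub_distrib]

/-- `𝓛_{s,q} 0 = 0`. [folklore] -/
theorem cfCongL_zero (s : ℂ) (x : ℝ) : cfCongL A q s (0 : ℝ → CfVec q) x = 0 := by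
  simp only [cfCongL, Pi.zero_apply, cfRep_zero, smul_zero, Finset.sum_const_zero]

/-- **Locality:** `𝓛_{s,q}[F](x)` only depends on the values of `F` at the points `g_a g_{a'} x`.
[folklore] -/
theorem cfCongL_congr (s : ℂ) {F G : ℝ → CfVec q} {x : ℝ}
    (h : ∀ a ∈ A, ∀ a' ∈ A, F (cfMoeb (cfGen a * cfGen a') x) = G (cfMoeb (cfGen a * cfGen a') x)) :
    cfCongL A q s F x = cfCongL A q s G x :=
  Finset.sum_congr rfl fun a ha => Finset.sum_congr rfl fun a' ha' => by rw [h a ha a' ha']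

/-- Locality on `I_A`: if `F = G` on `I` then `𝓛F = 𝓛G` on `I_A`. [folklore] -/
theorem cfCongL_congr_of_eqOn (s : ℂ) {F G : ℝ → CfVec q} (h : EqOn F G (cfI A))
    {x : ℝ} (hx : x ∈ cfIA A) : cfCongL A q s F x = cfCongL A q s G x :=
  cfCongL_congr A s fun a ha a' ha' => h (cfCyl_subset_cfI ha ha' (cfMoeb_pair_mem_cfCyl a a' hx))

/-- **Pointwise domination by the positive operator:**
`‖𝓛_{s,q}[F](x)‖ ≤ Σ_{a,a'} (denom(g_a g_{a'},x)²)^{-Re s} ‖F(g_a g_{a'} x)‖` (`x ≥ 0`; `ρ` is an isometry).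
[cite: MageeOhWinter2019, Lemma 23] -/
theorem norm_cfCongL_le (s : ℂ) (F : ℝ → CfVec q) {x : ℝ} (hx : 0 ≤ x) :
    ‖cfCongL A q s F x‖ ≤ ∑ a ∈ A, ∑ a' ∈ A,
      ((cfDenom (cfGen a * cfGen a') x) ^ 2) ^ (-s.re) * ‖F (cfMoeb (cfGen a * cfGen a') x)‖ := by
  refine (norm_sum_le _ _).trans (Finset.sum_le_sum fun a _ => (norm_sum_le _ _).trans
    (Finset.sum_le_sum fun a' _ => ?_))
  rw [norm_smul, norm_cfRep, norm_cfWt s _ (lt_of_lt_of_le one_pos (one_le_cfDenom_pair a a' hx))]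

/-- `𝓛_{s,q}` preserves "values orthogonal to the constants": if `Σ_η F(y)_η = 0` at the points
`y = g_a g_{a'} x` then `Σ_η (𝓛F)(x)_η = 0`. [cite: MageeOhWinter2019, §3.4] -/
theorem sum_cfCongL_apply_eq_zero (s : ℂ) {F : ℝ → CfVec q} {x : ℝ}
    (h : ∀ a ∈ A, ∀ a' ∈ A, ∑ η, F (cfMoeb (cfGen a * cfGen a') x) η = 0) :
    ∑ η, cfCongL A q s F x η = 0 := by
  have e : ∀ η, cfCongL A q s F x η = ∑ a ∈ A, ∑ a' ∈ A,
      cfWt s (cfGen a * cfGen a') x * (cfRep (cfRed q (cfPair a a')) (F (cfMoeb (cfGen a * cfGen a') x))) η := by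
    intro η
    simp only [cfCongL, WithLp.ofLp_sum, Finset.sum_apply, WithLp.ofLp_smul, Pi.smul_apply, smul_eq_mul]
  simp_rw [e]
  rw [Finset.sum_comm]
  refine Finset.sum_eq_zero fun a ha => ?_
  rw [Finset.sum_comm]
  refine Finset.sum_eq_zero fun a' ha' => ?_
  rw [← Finset.mul_sum, sum_cfRep_apply, h a ha a' ha', mul_zero]

end CongL

/-! ### The `C¹` norm (eq. (2.3)) -/

/-- The `C¹(S; E)` norm `‖F‖_∞ + ‖F'‖_∞` of eq. (2.3): suprema over `S` of the pointwise norms of `F`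
and of its derivative within `S` (for `S = I` a finite union of nondegenerate closed intervals this is
the one-sided derivative at endpoints). Real `iSup`s: the genuine norm when `F` is `C¹` on a compact `S`.
[cite: MageeOhWinter2019, eq. (2.3)] -/
def c1NormOn {E : Type*} [NormedAddCommGroup E] [NormedSpace ℝ E] (S : Set ℝ) (F : ℝ → E) : ℝ :=
  (⨆ x : S, ‖F x‖) + ⨆ x : S, ‖derivWithin F S x‖

section C1

variable {E : Type*} [NormedAddCommGroup E] [NormedSpace ℝ E] {S : Set ℝ} {F : ℝ → E}

/-- `‖F‖_{C¹} ≥ 0`. [folklore] -/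
theorem c1NormOn_nonneg (S : Set ℝ) (F : ℝ → E) : 0 ≤ c1NormOn S F :=
  add_nonneg (Real.iSup_nonneg fun _ => norm_nonneg _) (Real.iSup_nonneg fun _ => norm_nonneg _)

/-- `‖F‖_{C¹} ≤ M + L` from pointwise bounds `‖F‖ ≤ M`, `‖F'‖ ≤ L` on `S` (`M, L ≥ 0`). [folklore] -/
theorem c1NormOn_le_of_bounds {M L : ℝ} (hM : 0 ≤ M) (hL : 0 ≤ L) (h1 : ∀ x ∈ S, ‖F x‖ ≤ M)
    (h2 : ∀ x ∈ S, ‖derivWithin F S x‖ ≤ L) : c1NormOn S F ≤ M + L := by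
  unfold c1NormOn
  rcases isEmpty_or_nonempty S with hS | hS
  · simp only [Real.iSup_of_isEmpty, add_zero]; linarith
  · exact add_le_add (ciSup_le fun x => h1 x x.2) (ciSup_le fun x => h2 x x.2)

/-- Pointwise values are bounded by `‖F‖_{C¹}` when the supremum is genuine (bounded range). [folklore] -/
theorem norm_le_c1NormOn (hb1 : BddAbove (range fun x : S => ‖F x‖)) {x : ℝ} (hx : x ∈ S) :
    ‖F x‖ ≤ c1NormOn S F := by
  have h1 : ‖F x‖ ≤ ⨆ y : S, ‖F y‖ := le_ciSup hb1 ⟨x, hx⟩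
  have h2 : 0 ≤ ⨆ y : S, ‖derivWithin F S y‖ := Real.iSup_nonneg fun _ => norm_nonneg _
  unfold c1NormOn; linarith

/-- Pointwise derivatives are bounded by `‖F‖_{C¹}` when the supremum is genuine (bounded range). [folklore] -/
theorem norm_derivWithin_le_c1NormOn (hb2 : BddAbove (range fun x : S => ‖derivWithin F S x‖)) {x : ℝ} (hx : x ∈ S) :
    ‖derivWithin F S x‖ ≤ c1NormOn S F := by
  have h1 : ‖derivWithin F S x‖ ≤ ⨆ y : S, ‖derivWithin F S y‖ := le_ciSup hb2 ⟨x, hx⟩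
  have h2 : 0 ≤ ⨆ y : S, ‖F y‖ := Real.iSup_nonneg fun _ => norm_nonneg _
  unfold c1NormOn; linarith

end C1

end Literature.NumberTheory.Sieve
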